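import Literature.AlgebraicGeometry.Frobenioids.ElementaryFrobenioid
import Literature.AlgebraicGeometry.Frobenioids.PerfFactorial
import Literature.AnabelianGeometry.EtaleTheta.DivisorMonoids

/-!
# Merge pass: the [FrdI] vocabulary of [EtTh] §§3–4 instantiated from the tree

`DivisorMonoids.lean` typed [EtTh] §3 over two HYPOTHESIS STRUCTURES for [FrdI] notions that were
not in the tree at the time: `FrdIMonoidStub` ([FrdI] Def. 2.4 (i)/(ii): perf-factorial, realification,
"`ℝ` supports"; Def. 1.1 (i): non-dilating) and `FrdICatStub D` ([FrdI] Def. 1.1: divisorial monoid on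
`D`; Def. 4.5 (ii): rational / strictly rational). The [FrdI] files have since landed
(`Frobenioids/PerfFactorial.lean`, `MonoidRealification.lean`, `ElementaryFrobenioid.lean`, seats
abc-iut-L1-t2 / abc-iut-found). This file records the CANONICAL instantiations, so that every
statement of `DivisorMonoids.lean`, `TemperedFrobenioid*.lean`, `BiKummer*.lean` can be read with the
tree's real definitions: `treeMonoidVocab : FrdIMonoidStub` and, for a category `D`,
`treeCatVocab D … : FrdICatStub D` (the two Def. 4.5 predicates "rational" / "strictly rational" are
still parameters — [FrdI] §4 is seat abc-iut-L1-t3's and not yet landed).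
Source of the notions: [MochizukiFrdI2008] Def. 1.1 (i)–(ii) p.19, Def. 2.4 (i)–(ii) pp.47–48; their
use: [MochizukiEtTh2009] Prop 3.4 p.74, Lem 3.5 p.75, Def 3.6 pp.76–77.
-/

namespace Literature.AnabelianGeometry.EtaleTheta

open CategoryTheory Opposite Literature.AlgebraicGeometry.Frobenioids

universe u v w

/-- The tree's reading of "`ι : M → N` exhibits `N` as the realification `M^rlf` of the perf-factorial
monoid `M`" ([FrdI] Def. 2.4 (i), kurims p.48): `M` is perf-factorial and `N` is isomorphic to
`M^rlf = h.Rlf` (`Frobenioids.IsPerfFactorial.Rlf`) compatibly with `M → M^pf → M^rlf`.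
[cite: MochizukiFrdI2008, Def. 2.4(i) p.48] -/
def IsRealificationVia (M N : Type w) [CommMonoid M] [CommMonoid N] (ι : M →* N) : Prop :=
  ∃ (h : IsPerfFactorial M) (e : N ≃* h.Rlf), ∀ m : M, e (ι m) = h.toRealification (Perfection.of M m)

/-- **The canonical `FrdIMonoidStub`**: perf-factorial = `Frobenioids.IsPerfFactorial`, realification
= `IsRealificationVia`, "`ℝ` supports" = `Frobenioids.Supports _ .R`, non-dilating =
`Frobenioids.IsNonDilating` ([FrdI] Def. 2.4 (i)–(ii), Def. 1.1 (i)).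
[cite: MochizukiEtTh2009, Def 3.6 p.76] -/
def treeMonoidVocab : FrdIMonoidStub.{w} where
  IsPerfFactorial M _ := IsPerfFactorial M
  IsRealification M N _ _ ι := IsRealificationVia M N ι
  RSupports M _ := Supports M .R
  IsNonDilating _ _ α := IsNonDilating α

/-- `treeMonoidVocab.IsPerfFactorial` is the tree's `IsPerfFactorial`. [cite: MochizukiEtTh2009, Def 3.6 p.76] -/
@[simp] theorem treeMonoidVocab_isPerfFactorial (M : Type w) [CommMonoid M] :
    treeMonoidVocab.IsPerfFactorial M ↔ IsPerfFactorial M := Iff.rfl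

/-- `treeMonoidVocab.RSupports` is the tree's `Supports _ ℝ`. [cite: MochizukiEtTh2009, Lem 3.5 p.75] -/
@[simp] theorem treeMonoidVocab_rSupports (M : Type w) [CommMonoid M] :
    treeMonoidVocab.RSupports M ↔ Supports M .R := Iff.rfl

/-- `treeMonoidVocab.IsNonDilating` is the tree's `IsNonDilating`. [cite: MochizukiEtTh2009, Prop 3.4 p.74] -/
@[simp] theorem treeMonoidVocab_isNonDilating (M : Type w) [CommMonoid M] (α : M →* M) :
    treeMonoidVocab.IsNonDilating M α ↔ IsNonDilating α := Iff.rfl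

variable (D : Type u) [Category.{v} D]

/-- **The canonical `FrdICatStub D`** as far as the tree goes: "divisorial monoid on `D`" = the tree's
`IsMonoidOn Φ ∧ Objectwise IsDivisorial Φ` ([FrdI] Def. 1.1 (i), (ii)); the [FrdI] Def. 4.5 (ii)
predicates "rational" / "strictly rational" remain parameters (TODO-merge(abc-iut-L1-t3)).
[cite: MochizukiEtTh2009, Def 3.6 p.77] -/
def treeCatVocab (IsRational IsStrictlyRational : (Dᵒᵖ ⥤ CommMonCat.{w}) → Prop) :
    FrdICatStub.{u, v, w} D where
  IsDivisorialOn Φ := IsMonoidOn Φ ∧ Objectwise (fun M _ => IsDivisorial M) Φ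
  IsRational := IsRational
  IsStrictlyRational := IsStrictlyRational

/-- `(treeCatVocab D _ _).IsDivisorialOn` is the tree's notion of a divisorial monoid on `D`.
[cite: MochizukiEtTh2009, Prop 3.4 p.74] -/
@[simp] theorem treeCatVocab_isDivisorialOn (IsRational IsStrictlyRational : (Dᵒᵖ ⥤ CommMonCat.{w}) → Prop)
    (Φ : Dᵒᵖ ⥤ CommMonCat.{w}) :
    (treeCatVocab D IsRational IsStrictlyRational).IsDivisorialOn Φ ↔
      IsMonoidOn Φ ∧ Objectwise (fun M _ => IsDivisorial M) Φ := Iff.rfl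

end Literature.AnabelianGeometry.EtaleTheta
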